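import Literature.NumberTheory.BeurlingPrimes.PrescribedZerosMultiset
import Literature.NumberTheory.BeurlingPrimes.BVPerron
import Literature.NumberTheory.BeurlingPrimes.DMVZeros
import HarnessLib

/-!
# BDR Theorem 3.2, the continued zeta function `E_M(s) e^{Z(s)}`: poles, bounds on the Perron contour, the residue at `1`

Topic `Literature/NumberTheory/BeurlingPrimes`, grouping namespace `BDRMultiset`. Everything in this file is PROVED.

Broucke–Debruyne–Révész (2023), proof of Theorem 3.2, after (3.4): "`ζ_𝒫(s) = E(s)e^{Z(s)}` … We now show the
asymptotic formula for `N_𝒫` via Perron inversion … shift the contour to the left, more precisely, to the broken line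
`Γ` … Set `ℛ_> = {ρ ∈ ℛ : Re ρ > σ₀}`, `𝒮_> = {ω ∈ 𝒮 : Re ω > σ₀}`. There might be some `ω ∈ 𝒮 ∖ 𝒮_>` lying on the
contour `Γ` … Applying the residue theorem, we find that the integral in (3.5) equals … `+ Σ_{ω∈𝒮_>} Res_{s=ω}(…)
+ (1/2πi)∫_Γ …`". This file prepares the data of that step for the tree's straight contour `Re s = σ_x = 1/2 + η`,
`η = (log x)^{−1/3}` (`BVPerron.lean`; for `η ≤ gap/2` the line passes at distance `≥ η` from every `ω ∈ 𝒮` and the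
poles crossed are `s = 1` and the `ω` with `Re ω > 1/2`, of order `m_ω`), abstractly in the continued factor `Z`:

* `contZ ℛ 𝒮 δ M Z s = E_M(s) e^{Z(s)}`; the pole-free numerators `hOne` at `s = 1` and `hOmega ω` at `ω ∈ 𝒮`
  (`contZ = hOne/(s − 1) = hOmega ω/(s − ω)^{m_ω}`), their differentiability, and `resA = hOne 1 ≠ 0`;
* `norm_bdrE_le` — `‖E_M(s)‖ ≤ 5 ∏_𝒮 (1 + |ω|/d) ∏_ℛ (1 + 2|ρ|) (1 + δ/(1/2−δ))^M` when `‖s − 1‖ ≥ 1/4`,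
  `‖s − ω‖ ≥ d`, `Re s > 1/2`; the gap `gapS`, the height `TS`, and the distance lemmas on the two lines and the strip;
* `norm_contZ_le` — **`‖E_M(s)e^{Z(s)}‖ ≤ Eb(η) · B_η(|t|)`** on `1/2 + η ≤ Re s ≤ 3/2` under the BDR bound (3.4) for
  `Z` (`B_η = BV.Bmaj`, the majorant of `BVPerron.lean`, with constant `3C/2`);
* `resA_real_pos` — for a Beurling system with `ζ_𝒫 = E_M e^Z` on `Re s > 1`: **`a = resA` is real and `> 0`**
  (`(σ−1)ζ_𝒫(σ) → a`, `ζ_𝒫(σ) ≥ 0`).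

## References
* [BrouckeDebruyneRevesz2023] F. Broucke, G. Debruyne, Sz. Gy. Révész, *Some examples of well-behaved Beurling
  number systems*, arXiv:2309.01567, Theorem 3.2 and its proof ((3.4)–(3.8)) (read).
* [BrouckeVindas2024] F. Broucke, J. Vindas, Math. Z. 307 (2024), proof of Theorem 3.1 (tree `BVPerron.lean`).
-/

noncomputable section

open Filter Topology Complex Set MeasureTheory
open scoped ComplexConjugate

namespace Literature.NumberTheory.BeurlingPrimes

open Literature.Barriers.RiemannHypothesis

namespace BDRMultiset

variable {R S : Multiset ℂ} {δ : ℝ} {M : ℕ} {Z : ℂ → ℂ}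

/-! ### The continued zeta function and its numerators -/

/-- `E_M(s) e^{Z(s)}`, the continuation of `ζ_𝒫`. [cite: BrouckeDebruyneRevesz2023, Theorem 3.2 ("ζ_𝒫(s) = E(s)e^{Z(s)}")] -/
def contZ (R S : Multiset ℂ) (δ : ℝ) (M : ℕ) (Z : ℂ → ℂ) (s : ℂ) : ℂ := bdrE R S δ M s * Complex.exp (Z s)

/-- The common pole-free factor `∏_ℛ (s−ρ)/s · (s/(s−δ))^M · e^{Z(s)}`. [cite: BrouckeDebruyneRevesz2023, Theorem 3.2] -/
def tailF (R : Multiset ℂ) (δ : ℝ) (M : ℕ) (Z : ℂ → ℂ) (s : ℂ) : ℂ :=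
  (R.map fun ρ ↦ (s - ρ) / s).prod * (s / (s - δ)) ^ M * Complex.exp (Z s)

/-- The numerator at the pole `s = 1`: `hOne(s) = s ∏_𝒮 s/(s−ω) · tailF(s)`, so `contZ = hOne/(s−1)`.
[cite: BrouckeDebruyneRevesz2023, proof of Theorem 3.2 (residue at s = 1)] -/
def hOne (R S : Multiset ℂ) (δ : ℝ) (M : ℕ) (Z : ℂ → ℂ) (s : ℂ) : ℂ :=
  s * (S.map fun ω ↦ s / (s - ω)).prod * tailF R δ M Z s

/-- The numerator at a pole `ω ∈ 𝒮` of order `m_ω = count ω 𝒮`: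
`hOmega ω s = s^{m_ω} · s/(s−1) · ∏_{ω'∈𝒮, ω'≠ω} s/(s−ω') · tailF(s)`, so `contZ = hOmega ω/(s−ω)^{m_ω}`.
[cite: BrouckeDebruyneRevesz2023, proof of Theorem 3.2 (residues at ω ∈ 𝒮_>)] -/
def hOmega (R S : Multiset ℂ) (δ : ℝ) (M : ℕ) (Z : ℂ → ℂ) (ω s : ℂ) : ℂ :=
  s ^ (S.count ω) * (s / (s - 1)) * ((S.filter fun ω' ↦ ω' ≠ ω).map fun ω' ↦ s / (s - ω')).prod *
    tailF R δ M Z s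

/-- The residue datum at `s = 1`: `a = hOne(1) = ∏_𝒮 1/(1−ω) ∏_ℛ (1−ρ) (1−δ)^{−M} e^{Z(1)}`.
[cite: BrouckeDebruyneRevesz2023, Theorem 3.2 ("a > 0")] -/
def resA (R S : Multiset ℂ) (δ : ℝ) (M : ℕ) (Z : ℂ → ℂ) : ℂ := hOne R S δ M Z 1

/-- `∏_𝒮 s/(s−ω') = (∏_{ω'≠ω} s/(s−ω')) · (s/(s−ω))^{m_ω}`. [folklore] -/
theorem prod_map_div_eq (S : Multiset ℂ) (ω s : ℂ) :
    (S.map fun ω' ↦ s / (s - ω')).prod =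
      ((S.filter fun ω' ↦ ω' ≠ ω).map fun ω' ↦ s / (s - ω')).prod * (s / (s - ω)) ^ (S.count ω) := by
  classical
  conv_lhs => rw [← Multiset.filter_add_not (fun ω' ↦ ω' ≠ ω) S]
  rw [Multiset.map_add, Multiset.prod_add]
  congr 1
  have hf : (S.filter fun ω' ↦ ¬ω' ≠ ω) = Multiset.replicate (S.count ω) ω := by
    rw [← Multiset.filter_eq' S ω]
    exact Multiset.filter_congr fun x _ ↦ by simp
  rw [hf, Multiset.map_replicate, Multiset.prod_replicate]

/-- `contZ = hOne/(s − 1)` off `s = 1`. [cite: BrouckeDebruyneRevesz2023, proof of Theorem 3.2] -/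
theorem contZ_eq_hOne_div {s : ℂ} (hs : s ≠ 1) : contZ R S δ M Z s = hOne R S δ M Z s / (s - 1) := by
  have h1 : s - 1 ≠ 0 := sub_ne_zero.2 hs
  simp only [contZ, hOne, bdrE, tailF]
  field_simp

/-- `contZ = hOmega ω/(s − ω)^{m_ω}` off `s = ω`. [cite: BrouckeDebruyneRevesz2023, proof of Theorem 3.2] -/
theorem contZ_eq_hOmega_div {ω s : ℂ} (hs : s ≠ ω) :
    contZ R S δ M Z s = hOmega R S δ M Z ω s / (s - ω) ^ (S.count ω) := by
  have h1 : s - ω ≠ 0 := sub_ne_zero.2 hs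
  have h2 : (s - ω) ^ (S.count ω) ≠ 0 := pow_ne_zero _ h1
  simp only [contZ, hOmega, bdrE, tailF]
  rw [prod_map_div_eq S ω s, div_pow]
  field_simp

/-! ### Differentiability -/

/-- A multiset product of functions differentiable at `z` is differentiable at `z`. [folklore] -/
theorem differentiableAt_multiset_prod {X : Multiset ℂ} {φ : ℂ → ℂ → ℂ} {z : ℂ}
    (h : ∀ a ∈ X, DifferentiableAt ℂ (φ a) z) : DifferentiableAt ℂ (fun s ↦ (X.map fun a ↦ φ a s).prod) z := by
  induction X using Multiset.induction_on with
  | empty => simp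
  | cons a X ih =>
    have ha := h a (Multiset.mem_cons_self a X)
    have hX := ih fun b hb ↦ h b (Multiset.mem_cons_of_mem hb)
    simp only [Multiset.map_cons, Multiset.prod_cons]
    exact ha.mul hX

/-- `s ↦ s/(s − c)` is differentiable at `z ≠ c`. [folklore] -/
theorem differentiableAt_div_sub {c z : ℂ} (hz : z ≠ c) : DifferentiableAt ℂ (fun s : ℂ ↦ s / (s - c)) z :=
  differentiableAt_id.div (differentiableAt_id.sub_const c) (sub_ne_zero.2 hz)

/-- `tailF` is differentiable at `z` with `Re z > 1/2 > δ`, `z ≠ 0`, when `Z` is. [folklore] -/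
theorem differentiableAt_tailF (hδ2 : δ < 1 / 2) {z : ℂ} (hz : 1 / 2 < z.re) (hZ : DifferentiableAt ℂ Z z) :
    DifferentiableAt ℂ (tailF R δ M Z) z := by
  have hz0 : z ≠ 0 := fun h ↦ by rw [h] at hz; simp at hz; linarith
  have hzδ : z ≠ (δ : ℂ) := fun h ↦ by rw [h] at hz; simp at hz; linarith
  unfold tailF
  refine ((differentiableAt_multiset_prod fun ρ _ ↦ ?_).mul ((differentiableAt_div_sub hzδ).pow M)).mul hZ.cexp
  exact (differentiableAt_id.sub_const ρ).div differentiableAt_id hz0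

/-- `hOne` is differentiable at `z` with `Re z > 1/2`, `z ∉ 𝒮`. [cite: BrouckeDebruyneRevesz2023, proof of Theorem 3.2] -/
theorem differentiableAt_hOne (hδ2 : δ < 1 / 2) {z : ℂ} (hz : 1 / 2 < z.re) (hzS : ∀ ω ∈ S, z ≠ ω)
    (hZ : DifferentiableAt ℂ Z z) : DifferentiableAt ℂ (hOne R S δ M Z) z := by
  unfold hOne
  exact (differentiableAt_id.mul (differentiableAt_multiset_prod fun ω hω ↦ differentiableAt_div_sub (hzS ω hω))).mul
    (differentiableAt_tailF hδ2 hz hZ)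

/-- `hOmega ω` is differentiable at `z` with `Re z > 1/2`, `z ≠ 1`, `z ≠ ω'` for `ω' ∈ 𝒮 ∖ {ω}`.
[cite: BrouckeDebruyneRevesz2023, proof of Theorem 3.2] -/
theorem differentiableAt_hOmega (hδ2 : δ < 1 / 2) {ω z : ℂ} (hz : 1 / 2 < z.re) (hz1 : z ≠ 1)
    (hzS : ∀ ω' ∈ S, ω' ≠ ω → z ≠ ω') (hZ : DifferentiableAt ℂ Z z) :
    DifferentiableAt ℂ (hOmega R S δ M Z ω) z := by
  unfold hOmega
  refine ((((differentiableAt_id.pow _).mul (differentiableAt_div_sub hz1)).mul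
    (differentiableAt_multiset_prod fun ω' hω' ↦ differentiableAt_div_sub ?_)).mul (differentiableAt_tailF hδ2 hz hZ))
  rw [Multiset.mem_filter] at hω'
  exact hzS ω' hω'.1 hω'.2

/-- `contZ` is differentiable at `z` with `Re z > 1/2`, `z ≠ 1`, `z ∉ 𝒮`. [cite: BrouckeDebruyneRevesz2023, proof of Theorem 3.2] -/
theorem differentiableAt_contZ (hδ2 : δ < 1 / 2) {z : ℂ} (hz : 1 / 2 < z.re) (hz1 : z ≠ 1) (hzS : ∀ ω ∈ S, z ≠ ω)
    (hZ : DifferentiableAt ℂ Z z) : DifferentiableAt ℂ (contZ R S δ M Z) z := by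
  have h : contZ R S δ M Z =ᶠ[𝓝 z] fun s ↦ hOne R S δ M Z s / (s - 1) := by
    filter_upwards [isOpen_ne.mem_nhds hz1] with s hs
    exact contZ_eq_hOne_div hs
  refine (DifferentiableAt.congr_of_eventuallyEq ?_ h)
  exact (differentiableAt_hOne hδ2 hz hzS hZ).div (differentiableAt_id.sub_const 1) (sub_ne_zero.2 hz1)

/-- `a = resA ≠ 0` (`Re ω, Re ρ < 1`, `δ < 1`). [cite: BrouckeDebruyneRevesz2023, Theorem 3.2 ("a > 0")] -/
theorem resA_ne_zero (hS : ∀ ω ∈ S, ω.re < 1) (hR : ∀ ρ ∈ R, ρ.re < 1) (hδ1 : δ < 1) : resA R S δ M Z ≠ 0 := by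
  unfold resA hOne tailF
  have h1S : ∀ ω ∈ S, (1 : ℂ) - ω ≠ 0 := fun ω hω h ↦ by
    have := congrArg Complex.re h; simp at this; linarith [hS ω hω]
  have h1R : ∀ ρ ∈ R, (1 : ℂ) - ρ ≠ 0 := fun ρ hρ h ↦ by
    have := congrArg Complex.re h; simp at this; linarith [hR ρ hρ]
  have h1δ : (1 : ℂ) - δ ≠ 0 := fun h ↦ by have := congrArg Complex.re h; simp at this; linarith
  have hPS : (S.map fun ω ↦ (1 : ℂ) / (1 - ω)).prod ≠ 0 := by
    refine Multiset.prod_ne_zero fun h ↦ ?_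
    obtain ⟨ω, hω, h0⟩ := Multiset.mem_map.1 h
    exact div_ne_zero one_ne_zero (h1S ω hω) h0
  have hPR : (R.map fun ρ ↦ ((1 : ℂ) - ρ) / 1).prod ≠ 0 := by
    refine Multiset.prod_ne_zero fun h ↦ ?_
    obtain ⟨ρ, hρ, h0⟩ := Multiset.mem_map.1 h
    exact div_ne_zero (h1R ρ hρ) one_ne_zero h0
  exact mul_ne_zero (mul_ne_zero one_ne_zero hPS)
    (mul_ne_zero (mul_ne_zero hPR (pow_ne_zero _ (div_ne_zero one_ne_zero h1δ))) (Complex.exp_ne_zero _))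

/-! ### Bounds for `E_M` -/

/-- Norm of a multiset product under termwise bounds. [folklore] -/
theorem norm_multiset_prod_le {X : Multiset ℂ} {φ : ℂ → ℂ} {B : ℂ → ℝ} (hB : ∀ a ∈ X, 0 ≤ B a)
    (h : ∀ a ∈ X, ‖φ a‖ ≤ B a) : ‖(X.map φ).prod‖ ≤ (X.map B).prod := by
  induction X using Multiset.induction_on with
  | empty => simp
  | cons a X ih =>
    have ha := h a (Multiset.mem_cons_self a X)
    have hBa := hB a (Multiset.mem_cons_self a X)
    have hX := ih (fun b hb ↦ hB b (Multiset.mem_cons_of_mem hb)) fun b hb ↦ h b (Multiset.mem_cons_of_mem hb)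
    have hXB : 0 ≤ (X.map B).prod :=
      Multiset.prod_nonneg fun y hy ↦ by obtain ⟨b, hb, rfl⟩ := Multiset.mem_map.1 hy; exact hB b (Multiset.mem_cons_of_mem hb)
    simp only [Multiset.map_cons, Multiset.prod_cons]
    exact (norm_mul_le _ _).trans (mul_le_mul ha hX (norm_nonneg _) hBa)

/-- The majorant constant `Eb(d) = 5 ∏_𝒮 (1 + |ω|/d) ∏_ℛ (1 + 2|ρ|) (1 + δ/(1/2−δ))^M` for `‖E_M‖`.
[cite: BrouckeDebruyneRevesz2023, proof of Theorem 3.2] -/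
def Eb (R S : Multiset ℂ) (δ : ℝ) (M : ℕ) (d : ℝ) : ℝ :=
  5 * (S.map fun ω ↦ 1 + ‖ω‖ / d).prod * (R.map fun ρ ↦ 1 + 2 * ‖ρ‖).prod * (1 + δ / (1 / 2 - δ)) ^ M

/-- `Eb(d) ≥ 0` for `d > 0`, `0 ≤ δ < 1/2`. [folklore] -/
theorem Eb_nonneg (hδ : 0 ≤ δ) (hδ2 : δ < 1 / 2) {d : ℝ} (hd : 0 < d) : 0 ≤ Eb R S δ M d := by
  unfold Eb
  have h1 : 0 ≤ (S.map fun ω ↦ 1 + ‖ω‖ / d).prod :=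
    Multiset.prod_nonneg fun y hy ↦ by obtain ⟨b, _, rfl⟩ := Multiset.mem_map.1 hy; positivity
  have h2 : 0 ≤ (R.map fun ρ ↦ 1 + 2 * ‖ρ‖).prod :=
    Multiset.prod_nonneg fun y hy ↦ by obtain ⟨b, _, rfl⟩ := Multiset.mem_map.1 hy; positivity
  have h3 : 0 ≤ 1 + δ / (1 / 2 - δ) := by have : 0 < 1 / 2 - δ := by linarith
                                          positivity
  positivity

/-- `Eb` is antitone in `d`: `Eb(d) ≤ Eb(d')` for `0 < d' ≤ d`. [folklore] -/
theorem Eb_mono (hδ : 0 ≤ δ) (hδ2 : δ < 1 / 2) {d d' : ℝ} (hd' : 0 < d') (hdd : d' ≤ d) :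
    Eb R S δ M d ≤ Eb R S δ M d' := by
  unfold Eb
  have hd : 0 < d := lt_of_lt_of_le hd' hdd
  have h2 : 0 ≤ (R.map fun ρ ↦ 1 + 2 * ‖ρ‖).prod :=
    Multiset.prod_nonneg fun y hy ↦ by obtain ⟨b, _, rfl⟩ := Multiset.mem_map.1 hy; positivity
  have h3 : 0 ≤ (1 + δ / (1 / 2 - δ)) ^ M := by
    have : 0 < 1 / 2 - δ := by linarith
    positivity
  have h1 : (S.map fun ω ↦ 1 + ‖ω‖ / d).prod ≤ (S.map fun ω ↦ 1 + ‖ω‖ / d').prod :=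
    Multiset.prod_map_le_prod_map₀ _ _ (fun ω _ ↦ by positivity) fun ω _ ↦ by
      gcongr
  have h1' : 0 ≤ (S.map fun ω ↦ 1 + ‖ω‖ / d).prod :=
    Multiset.prod_nonneg fun y hy ↦ by obtain ⟨b, _, rfl⟩ := Multiset.mem_map.1 hy; positivity
  gcongr

/-- **`‖E_M(s)‖ ≤ Eb(d)`** when `Re s > 1/2 > δ ≥ 0`, `‖s − 1‖ ≥ 1/4`, `‖s − ω‖ ≥ d > 0` (`ω ∈ 𝒮`):
`‖s/(s−1)‖ ≤ 5`, `‖s/(s−ω)‖ ≤ 1 + |ω|/d`, `‖(s−ρ)/s‖ ≤ 1 + 2|ρ|`, `‖s/(s−δ)‖ ≤ 1 + δ/(1/2−δ)`.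
[cite: BrouckeDebruyneRevesz2023, proof of Theorem 3.2 ("E_M(s) ≪ |t|^M" on the contour)] -/
theorem norm_bdrE_le (hδ : 0 ≤ δ) (hδ2 : δ < 1 / 2) {s : ℂ} (hs : 1 / 2 < s.re) (h1 : 1 / 4 ≤ ‖s - 1‖) {d : ℝ}
    (hd : 0 < d) (hdS : ∀ ω ∈ S, d ≤ ‖s - ω‖) : ‖bdrE R S δ M s‖ ≤ Eb R S δ M d := by
  have hs0 : (1 : ℝ) / 2 ≤ ‖s‖ := le_trans hs.le (Complex.re_le_norm s)
  have hsne : s ≠ 0 := fun h ↦ by rw [h] at hs; simp at hs; linarith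
  -- the four factors
  have f1 : ‖s / (s - 1)‖ ≤ 5 := BV.norm_div_sub_one_le h1
  have f2 : ‖(S.map fun ω ↦ s / (s - ω)).prod‖ ≤ (S.map fun ω ↦ 1 + ‖ω‖ / d).prod := by
    refine norm_multiset_prod_le (fun ω _ ↦ by positivity) fun ω hω ↦ ?_
    have hsω : s - ω ≠ 0 := fun h ↦ by
      have := hdS ω hω; rw [h, norm_zero] at this; linarith
    have heq : s / (s - ω) = 1 + ω / (s - ω) := by field_simp; ring
    rw [heq]
    refine (norm_add_le _ _).trans ?_
    rw [norm_one, norm_div]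
    exact add_le_add le_rfl (div_le_div_of_nonneg_left (norm_nonneg ω) hd (hdS ω hω))
  have f3 : ‖(R.map fun ρ ↦ (s - ρ) / s).prod‖ ≤ (R.map fun ρ ↦ 1 + 2 * ‖ρ‖).prod := by
    refine norm_multiset_prod_le (fun ρ _ ↦ by positivity) fun ρ _ ↦ ?_
    have heq : (s - ρ) / s = 1 - ρ / s := by field_simp
    rw [heq]
    refine (norm_sub_le _ _).trans ?_
    rw [norm_one, norm_div]
    refine add_le_add le_rfl ?_
    rw [div_le_iff₀ (by linarith)]
    nlinarith [norm_nonneg ρ]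
  have f4 : ‖(s / (s - δ)) ^ M‖ ≤ (1 + δ / (1 / 2 - δ)) ^ M := by
    rw [norm_pow]
    refine pow_le_pow_left₀ (norm_nonneg _) ?_ M
    have hsδ : 1 / 2 - δ < ‖s - δ‖ := by
      have := Complex.re_le_norm (s - δ)
      simp at this
      linarith
    have hsδ0 : s - δ ≠ 0 := fun h ↦ by rw [h, norm_zero] at hsδ; linarith
    have heq : s / (s - δ) = 1 + δ / (s - δ) := by field_simp; ring
    rw [heq]
    refine (norm_add_le _ _).trans ?_
    rw [norm_one, norm_div, Complex.norm_real, Real.norm_eq_abs, abs_of_nonneg hδ]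
    exact add_le_add le_rfl (div_le_div_of_nonneg_left hδ (by linarith) hsδ.le)
  have p2 : 0 ≤ (S.map fun ω ↦ 1 + ‖ω‖ / d).prod :=
    Multiset.prod_nonneg fun y hy ↦ by obtain ⟨b, _, rfl⟩ := Multiset.mem_map.1 hy; positivity
  have p3 : 0 ≤ (R.map fun ρ ↦ 1 + 2 * ‖ρ‖).prod :=
    Multiset.prod_nonneg fun y hy ↦ by obtain ⟨b, _, rfl⟩ := Multiset.mem_map.1 hy; positivity
  rw [bdrE, Eb, norm_mul, norm_mul, norm_mul]
  gcongr

/-! ### The gap, the height, and distances to the poles -/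

/-- The gap `min(1, min_{ω ∈ 𝒮, Re ω > 1/2} (Re ω − 1/2)) > 0`. [cite: BrouckeDebruyneRevesz2023, proof of Theorem 3.2 ("𝒮_>")] -/
def gapS (S : Multiset ℂ) : ℝ :=
  (insert (1 : ℝ) ((S.toFinset.filter fun ω ↦ 1 / 2 < ω.re).image fun ω ↦ ω.re - 1 / 2)).min'
    (Finset.insert_nonempty _ _)

/-- `0 < gapS ≤ 1`. [folklore] -/
theorem gapS_pos_le : 0 < gapS S ∧ gapS S ≤ 1 := by
  classical
  unfold gapS
  refine ⟨?_, Finset.min'_le _ _ (Finset.mem_insert_self _ _)⟩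
  rw [Finset.lt_min'_iff]
  intro y hy
  rcases Finset.mem_insert.1 hy with h | h
  · rw [h]; exact one_pos
  · obtain ⟨ω, hω, rfl⟩ := Finset.mem_image.1 h
    rw [Finset.mem_filter] at hω
    linarith [hω.2]

/-- `gapS ≤ Re ω − 1/2` for every `ω ∈ 𝒮` with `Re ω > 1/2`. [folklore] -/
theorem gapS_le {ω : ℂ} (hω : ω ∈ S) (hre : 1 / 2 < ω.re) : gapS S ≤ ω.re - 1 / 2 := by
  classical
  unfold gapS
  refine Finset.min'_le _ _ (Finset.mem_insert_of_mem (Finset.mem_image.2 ⟨ω, ?_, rfl⟩))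
  rw [Finset.mem_filter, Multiset.mem_toFinset]
  exact ⟨hω, hre⟩

/-- The height `T_𝒮 = 1 + Σ_𝒮 |Im ω|` beyond which the strip is at distance `≥ 1` from every pole. [folklore] -/
def TS (S : Multiset ℂ) : ℝ := 1 + (S.map fun ω ↦ |ω.im|).sum

/-- `1 ≤ T_𝒮` and `|Im ω| ≤ T_𝒮 − 1` for `ω ∈ 𝒮`. [folklore] -/
theorem TS_facts : 1 ≤ TS S ∧ ∀ ω ∈ S, |ω.im| ≤ TS S - 1 := by
  have hnn : 0 ≤ (S.map fun ω ↦ |ω.im|).sum :=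
    Multiset.sum_nonneg fun y hy ↦ by obtain ⟨b, _, rfl⟩ := Multiset.mem_map.1 hy; exact abs_nonneg _
  refine ⟨by unfold TS; linarith, fun ω hω ↦ ?_⟩
  unfold TS
  have h := Multiset.single_le_sum (fun y hy ↦ by obtain ⟨b, _, rfl⟩ := Multiset.mem_map.1 hy; exact abs_nonneg _)
    _ (Multiset.mem_map_of_mem (fun ω ↦ |ω.im|) hω)
  linarith

/-- **On the line `Re s = 1/2 + η` with `0 < η ≤ gapS/2`: `‖s − ω‖ ≥ η` for all `ω ∈ 𝒮`** (poles with `Re ω ≤ 1/2`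
are at horizontal distance `≥ η` to the left, the others at distance `≥ gapS − η ≥ η` to the right).
[cite: BrouckeDebruyneRevesz2023, proof of Theorem 3.2 (choice of the contour)] -/
theorem dist_line_ge {η : ℝ} (hη : 0 < η) (hηg : η ≤ gapS S / 2) {s : ℂ} (hs : s.re = 1 / 2 + η) {ω : ℂ}
    (hω : ω ∈ S) : η ≤ ‖s - ω‖ := by
  have hre := Complex.abs_re_le_norm (s - ω)
  simp only [sub_re] at hre
  rcases le_or_gt ω.re (1 / 2) with h | h
  · have : η ≤ |s.re - ω.re| := by rw [abs_of_nonneg (by linarith)]; linarith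
    exact this.trans hre
  · have hg := gapS_le hω h
    have : η ≤ |s.re - ω.re| := by rw [abs_of_nonpos (by linarith)]; linarith
    exact this.trans hre

/-- On the line `Re s = 3/2`: `‖s − ω‖ ≥ 1/2` for `ω ∈ 𝒮` (`Re ω < 1`). [folklore] -/
theorem dist_right_ge (hS : ∀ ω ∈ S, ω.re < 1) {s : ℂ} (hs : s.re = 3 / 2) {ω : ℂ} (hω : ω ∈ S) :
    1 / 2 ≤ ‖s - ω‖ := by
  have hre := Complex.abs_re_le_norm (s - ω)
  simp only [sub_re] at hre
  have : 1 / 2 ≤ |s.re - ω.re| := by rw [abs_of_nonneg (by linarith [hS ω hω])]; linarith [hS ω hω]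
  exact this.trans hre

/-- In the strip at height `|Im s| ≥ T_𝒮`: `‖s − ω‖ ≥ 1` for `ω ∈ 𝒮`. [folklore] -/
theorem dist_strip_ge {s : ℂ} (hs : TS S ≤ |s.im|) {ω : ℂ} (hω : ω ∈ S) : 1 ≤ ‖s - ω‖ := by
  have him := Complex.abs_im_le_norm (s - ω)
  simp only [sub_im] at him
  have h := (TS_facts (S := S)).2 ω hω
  have : 1 ≤ |s.im - ω.im| := by
    have := abs_sub_abs_le_abs_sub s.im ω.im
    linarith
  exact this.trans him

/-! ### The bound `‖E_M(s) e^{Z(s)}‖ ≤ Eb(η) B_η(|t|)` -/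

/-- **`‖contZ(s)‖ ≤ Eb(η) · B_η(|Im s|)`** for `1/2 + η ≤ Re s ≤ 3/2` (`0 < η`), `‖s − 1‖ ≥ 1/4`,
`‖s − ω‖ ≥ η` (`ω ∈ 𝒮`), under (3.4) `‖Z(σ+it)‖ ≤ C(σ/(σ−1/2) + σ√(log(|t|+1)/(σ−1/2)))` (`σ > 1/2`):
`‖Z(s)‖ ≤ (3C/2)(1/η + √log(|t|+1)/√η)`, so `‖e^{Z}‖ ≤ B_η/8` with `B_η = BV.Bmaj (3C/2) η`.
[cite: BrouckeDebruyneRevesz2023, proof of Theorem 3.2 ((3.4) and "e^{Z(s)}" on the contour)] -/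
theorem norm_contZ_le (hδ : 0 ≤ δ) (hδ2 : δ < 1 / 2) {C : ℝ} (hC : 0 ≤ C)
    (hZb : ∀ σ t : ℝ, 1 / 2 < σ → ‖Z (σ + t * I)‖ ≤ C * (σ / (σ - 1 / 2) + σ * Real.sqrt (Real.log (|t| + 1) / (σ - 1 / 2))))
    {η : ℝ} (hη : 0 < η) {s : ℂ} (hs : 1 / 2 + η ≤ s.re) (hs2 : s.re ≤ 3 / 2) (h1 : 1 / 4 ≤ ‖s - 1‖)
    (hdS : ∀ ω ∈ S, η ≤ ‖s - ω‖) :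
    ‖contZ R S δ M Z s‖ ≤ Eb R S δ M η * BV.Bmaj (3 / 2 * C) η |s.im| := by
  have hσ : 1 / 2 < s.re := by linarith
  have hE := norm_bdrE_le (R := R) (M := M) hδ hδ2 hσ h1 hη hdS
  have hE0 := Eb_nonneg (R := R) (S := S) (M := M) hδ hδ2 hη
  -- the bound for `Z s`
  set ℓ : ℝ := Real.log (|s.im| + 1) with hℓ
  have hℓ0 : 0 ≤ ℓ := Real.log_nonneg (by linarith [abs_nonneg s.im])
  have hZ := hZb s.re s.im hσ
  rw [Complex.re_add_im] at hZ
  have hε : 0 < s.re - 1 / 2 := by linarith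
  have h1' : s.re / (s.re - 1 / 2) ≤ 3 / 2 * (1 / η) := by
    rw [div_le_iff₀ hε, mul_one_div, div_mul_eq_mul_div, le_div_iff₀ hη]; nlinarith
  have h2' : s.re * Real.sqrt (ℓ / (s.re - 1 / 2)) ≤ 3 / 2 * (Real.sqrt ℓ / Real.sqrt η) := by
    rw [Real.sqrt_div hℓ0]
    have h3 : Real.sqrt ℓ / Real.sqrt (s.re - 1 / 2) ≤ Real.sqrt ℓ / Real.sqrt η :=
      div_le_div_of_nonneg_left (Real.sqrt_nonneg _) (Real.sqrt_pos.mpr hη) (Real.sqrt_le_sqrt (by linarith))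
    have h4 : 0 ≤ Real.sqrt ℓ / Real.sqrt (s.re - 1 / 2) := by positivity
    nlinarith
  set C₁ : ℝ := 3 / 2 * C with hC₁
  have hZ' : ‖Z s‖ ≤ C₁ / η + C₁ / Real.sqrt η * Real.sqrt ℓ := by
    calc ‖Z s‖ ≤ C * (s.re / (s.re - 1 / 2) + s.re * Real.sqrt (ℓ / (s.re - 1 / 2))) := hZ
      _ ≤ C * (3 / 2 * (1 / η) + 3 / 2 * (Real.sqrt ℓ / Real.sqrt η)) := mul_le_mul_of_nonneg_left (add_le_add h1' h2') hC
      _ = C₁ / η + C₁ / Real.sqrt η * Real.sqrt ℓ := by rw [hC₁]; ring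
  have hexp : ‖Complex.exp (Z s)‖ ≤ Real.exp (C₁ / η) * Real.exp (C₁ / Real.sqrt η * Real.sqrt ℓ) := by
    rw [Complex.norm_exp, ← Real.exp_add]
    exact Real.exp_le_exp.mpr ((Complex.re_le_norm _).trans hZ')
  have hB : Real.exp (C₁ / η) * Real.exp (C₁ / Real.sqrt η * Real.sqrt ℓ) ≤ BV.Bmaj C₁ η |s.im| := by
    rw [BV.Bmaj_abs]
    have : 0 ≤ Real.exp (C₁ / η) * Real.exp (C₁ / Real.sqrt η * Real.sqrt ℓ) := by positivity
    nlinarith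
  rw [contZ, norm_mul]
  exact mul_le_mul hE (hexp.trans hB) (norm_nonneg _) hE0

/-! ### The residue `a` is a positive real -/

/-- `(σ − 1) ζ_𝒫(σ) → a` as `σ → 1⁺` when `ζ_𝒫 = contZ` on `Re s > 1` (`(σ−1) contZ(σ) = hOne(σ)`).
[cite: BrouckeDebruyneRevesz2023, Theorem 3.2 ("a > 0")] -/
theorem tendsto_sub_one_mul_zeta {P : BeurlingPrimes} (hδ2 : δ < 1 / 2) (hS : ∀ ω ∈ S, ω.re < 1)
    (hzeta : ∀ s : ℂ, 1 < s.re → P.zeta s = contZ R S δ M Z s) (hZ1 : DifferentiableAt ℂ Z 1) :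
    Tendsto (fun σ : ℝ ↦ ((σ : ℂ) - 1) * P.zeta σ) (𝓝[>] 1) (𝓝 (resA R S δ M Z)) := by
  have h1S : ∀ ω ∈ S, (1 : ℂ) ≠ ω := fun ω hω h ↦ by
    have := congrArg Complex.re h; simp at this; linarith [hS ω hω]
  have hcont : ContinuousAt (hOne R S δ M Z) 1 :=
    (differentiableAt_hOne hδ2 (by norm_num) h1S hZ1).continuousAt
  have hof : Tendsto (fun σ : ℝ ↦ (σ : ℂ)) (𝓝[>] (1 : ℝ)) (𝓝 (1 : ℂ)) :=
    (Complex.continuous_ofReal.tendsto' 1 1 (by simp)).mono_left nhdsWithin_le_nhds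
  have h1 : Tendsto (fun σ : ℝ ↦ hOne R S δ M Z σ) (𝓝[>] (1 : ℝ)) (𝓝 (resA R S δ M Z)) := hcont.tendsto.comp hof
  refine h1.congr' ?_
  refine eventually_nhdsWithin_of_forall fun σ hσ ↦ ?_
  have hσ1 : (1 : ℝ) < σ := hσ
  have hne1 : (σ : ℂ) ≠ 1 := fun h0 ↦ by
    have := congrArg Complex.re h0; simp at this; linarith
  have hne : (σ : ℂ) - 1 ≠ 0 := sub_ne_zero.2 hne1
  show hOne R S δ M Z σ = ((σ : ℂ) - 1) * P.zeta σ
  rw [hzeta σ (by simpa using hσ1), contZ_eq_hOne_div hne1]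
  field_simp

/-- **`a` is a positive real number** (`Im a = 0`, `Re a > 0`): limit of the non-negative reals `(σ−1)ζ_𝒫(σ)`,
and `a ≠ 0`. [cite: BrouckeDebruyneRevesz2023, Theorem 3.2 ("a > 0")] -/
theorem resA_real_pos {P : BeurlingPrimes} (hδ2 : δ < 1 / 2) (hS : ∀ ω ∈ S, ω.re < 1) (hR : ∀ ρ ∈ R, ρ.re < 1)
    (hzeta : ∀ s : ℂ, 1 < s.re → P.zeta s = contZ R S δ M Z s) (hZ1 : DifferentiableAt ℂ Z 1) :
    (resA R S δ M Z).im = 0 ∧ 0 < (resA R S δ M Z).re := by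
  have hne : resA R S δ M Z ≠ 0 := resA_ne_zero hS hR (by linarith)
  have hreal : (resA R S δ M Z).im = 0 ∧ 0 ≤ (resA R S δ M Z).re := by
    refine DMV.Template.mem_of_tendsto_nonneg_real (tendsto_sub_one_mul_zeta hδ2 hS hzeta hZ1) ?_
    refine eventually_nhdsWithin_of_forall fun σ hσ ↦ ?_
    have hσ1 : (1 : ℝ) < σ := hσ
    obtain ⟨him, hre⟩ := DMV.Template.zeta_ofReal_mem P σ
    have hsub : ((σ : ℂ) - 1) = ((σ - 1 : ℝ) : ℂ) := by push_cast; ring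
    rw [hsub, Complex.re_ofReal_mul, Complex.im_ofReal_mul, him, mul_zero]
    exact ⟨rfl, mul_nonneg (by linarith) hre⟩
  refine ⟨hreal.1, lt_of_le_of_ne hreal.2 fun h0 ↦ hne (Complex.ext ?_ ?_)⟩
  · simp [← h0]
  · simp [hreal.1]

/-- `a` as a complex number is the real number `Re a`. [folklore] -/
theorem resA_eq_ofReal {P : BeurlingPrimes} (hδ2 : δ < 1 / 2) (hS : ∀ ω ∈ S, ω.re < 1) (hR : ∀ ρ ∈ R, ρ.re < 1)
    (hzeta : ∀ s : ℂ, 1 < s.re → P.zeta s = contZ R S δ M Z s) (hZ1 : DifferentiableAt ℂ Z 1) :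
    resA R S δ M Z = (((resA R S δ M Z).re : ℝ) : ℂ) :=
  Complex.ext (by simp) (by simp [(resA_real_pos hδ2 hS hR hzeta hZ1).1])

end BDRMultiset

end Literature.NumberTheory.BeurlingPrimes
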